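import Mathlib
import HarnessLib
import HarnessLib.Audit
import Summits.NavierStokesRegularity.Statement
import Literature.Analysis.FluidPDE.ClassicalSolution
import Literature.Analysis.FluidPDE.LerayHopf
import Literature.Analysis.FluidPDE.NSWave0
import Literature.Analysis.FluidPDE.LocalTypeI
import Literature.Analysis.FluidPDE.VectorCalculus
import Literature.Analysis.FluidPDE.Vorticity
import Literature.Analysis.FluidPDE.NSBoundedMildOseen
import Literature.Analysis.UnboundedOperators.HeatKernel
import Literature.Analysis.FluidPDE.SereginSverak2002PressureLowerBound
import HarnessLib.Audit.Status.Attr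

/-!
Route: HalfSpaceWindowDoor

# Route HalfSpaceWindowDoor — Closed-hemisphere vorticity under local Type I forces regularity via
conserved one-signed plane circulation

RUNG-LEAF ROUTE (D-0061/D-0145 LINE; leaf = the requested rung N0-LocalTubeDoorHalfSpace of
LADDER-NS = this route's own `Target` item, the CLOSED-HEMISPHERE WINDOW DOOR; it does NOT claim
Clay (A); no summit is proved by a line). It suffices to show X = K2 ∧ K3 ∧ S9 where S9 =
HalfSpaceZoom (at a locally Type-I point that is not backward bounded, if the negative part of one
fixed vorticity component ⟪(T−t)ω, e⟫ fades in mean square on every bounded similarity window, a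
point zoom produces a Type-I ancient Oseen-mild profile, backward singular at the apex, with ⟪curl
v, e⟫ ≥ 0 everywhere), K3 = PoloidalWindowRigidity (shared VERBATIM with route PoloidalWindowDoor,
item stmt-NavierStokesRegularity-19708: profiles with ⟪curl v,e⟫ ≡ 0 on open sets of every slice are
not backward singular) and K2 = CirculationCarryingRigidity (NEW: profiles with ⟪curl v, e⟫ ≥ 0
everywhere and > 0 somewhere are not backward singular). Technique card: assume-the-opposite — zoom
the putative one-signed singularity into a closed-hemisphere Type-I profile and break it by its
conserved sign-definite plane circulation.
Lean: `∀ (ν T : ℝ), 0 < ν → 0 < T → ∀ (u : ℝ → EuclideanSpace ℝ (Fin 3) → EuclideanSpace ℝ (Fin 3))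
(p : ℝ → EuclideanSpace ℝ (Fin 3) → ℝ), Literature.Analysis.FluidPDE.IsClassicalNSSolutionOn
(Set.Ico 0 T) ν 0 u p → Literature.Analysis.FluidPDE.IsLerayHopfOn T ν 0 (u 0) u →
Literature.Analysis.FluidPDE.HasRapidSpatialDecay (u 0) → ∀ (x₀ : EuclideanSpace ℝ (Fin 3)) (ρ M :
ℝ), 0 < ρ → (∀ t ∈ Set.Ico 0 T, T - ρ ^ 2 < t → ∀ x ∈ Metric.ball x₀ ρ, ‖u t x‖ * Real.sqrt (ν * (T
- t)) ≤ M) → ∀ (e : EuclideanSpace ℝ (Fin 3)), e ≠ 0 → (∀ R : ℝ, 0 < R → Filter.Tendsto (fun t => ∫⁻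
y in Metric.ball (0 : EuclideanSpace ℝ (Fin 3)) R, ENNReal.ofReal ((min (⟪(T - t) •
Literature.Analysis.FluidPDE.curl (u t) (x₀ + Real.sqrt (T - t) • y), e⟫_ℝ) 0) ^ 2)) (nhdsWithin T
(Set.Iio T)) (nhds 0)) → Literature.Analysis.FluidPDE.IsBackwardBoundedAt u T x₀`

## Assembly
Pure logic, certified in Sketch.lean / glue.lean (farm rc 0, 0 sorry): assume the Target's
hypotheses and, for contradiction, that u is not backward bounded at (x₀,T); HalfSpaceZoom gives a
closed-hemisphere profile v, backward singular at the apex; either ⟪curl v(s,y),e⟫ > 0 at some (s,y)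
— then CirculationCarryingRigidity says v is not backward singular — or ⟪curl v,e⟫ ≤ 0 everywhere,
hence ≡ 0 by the sign condition, and PoloidalWindowRigidity (b) with U = univ on every slice says
the same; contradiction either way.

CLOSES_TARGET: closes rung N0-LocalTubeDoorHalfSpace (DOOR) of NavierStokesRegularity: Summit.NavierStokesRegularity.NavierStokesRegularity.Theses.HalfSpaceWindowDoor.Target (D-0061; not the summit Statement) — the deciding theorem of this route concludes that registered leaf instead of the Statement decl `NavierStokesRegularity` (class rung: servable and labelled, never counted as concluding the summit Statement).

Rationale: WHY THIS LINE. Lei–Ren–Tian (arXiv:2501.08976, Thm 1.1, Rem 1.3 p.4) prove regularity when the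
vorticity DIRECTIONS stay in a double cone of aperture < π/2 and name the half-space (closed
hemisphere, aperture π) as the natural open case, 'nontrivial even for axisymmetric solutions';
under LOCAL TYPE I the axisymmetric case is a theorem (KNSS2009 Thms 6.1–6.2 = in-tree
`Literature.Analysis.FluidPDE.knss_no_axisymmetric_typeI`; SereginSverak2009 =
`Literature.Barriers.NavierStokesRegularity.AxisymmetricTypeIExclusion`), so the Type-I half-space
door is the next rung of that geometric ladder and is absent from the tree's door family S13–S23
(Sine = double cone, Poloidal = ⟪ω,e⟫ ≡ 0, VelComp, Lamb, Helicity, …). The new lever (why K2 is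
easier than the one-component Liouville (L′)/stmt-4050 and than the helicity/poloidal strata): with
ω·e ≥ 0 the signed flux through a plane ⟂ e equals the absolute flux, the plane flux Φ(z,t) =
∫⟪ω,e⟫dx_h is a circulation (Stokes) hence ≤ O(R/√(−t)) a priori and O(1) in scale-free mean by the
PROVED FarPastLedger (stmt-14060: ∫_(B_R)|u|² ≤ K R), and Φ solves the 1D HEAT EQUATION ∂_tΦ = ∂_z²Φ
because the transport–tilting flux v₃ω − ω₃v of the ⟪ω,e⟫-equation has identically zero e-component
— so Φ is a bounded nonnegative ancient caloric function, i.e. a CONSTANT conserved circulation Φ₀ >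
0 carried through every plane at every time; the crux is then a 2D-like positivity/smoothing (Nash,
Carlen–Loss drift-independent bounds for divergence-form equations) statement against the critical
tilting source, on a class whose vortex lines are z-monotone curves (no hairpins). In tree this
identity is the ZERO-FOLD STRATUM of the fold law of route SlicedKelvin (card
planar-fold-law-unsigned-flux; ε-regularised fold law = item stmt-NavierStokesRegularity-15606
FoldLawEps, PROVED): for the one direction e the closed-hemisphere class has no tangency folds, so
the unsigned flux needs no fold budget (SlicedKelvin's open crux K1) and is exactly conserved — this
line spends that free conservation on a Type-I door instead of a global a-priori bound, and its
Liouville-type crux is incomparable with SlicedKelvin's PlanarFluxLiouville (stmt-15601: BOUNDED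
ancient class, bounded unsigned flux through ALL planes ⇒ constant) — here the class is
Type-I-singular and the hypothesis is a SIGN in ONE direction. Imported from: parabolic
Liouville/Widder theory for nonnegative caloric functions and divergence-free-drift regularity
(SSSZ2012 = arXiv:1010.6025); nothing from the cone of the other routes, which either average B
(barred by N8(i)), classify germs locally (PoloidalWindowDoor lines lrc-jet/slicesharp), or use
helicity/Beltrami structure.

RANKED CRUXES. #0 Target (target) — The closed-hemisphere window door: ν>0, T>0, (u,p) classical NS
on [0,T), Leray–Hopf from a rapidly decaying datum, locally Type I at (x₀,T) on B(x₀,ρ) × (T−ρ², T);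
if for one fixed e ≠ 0 and EVERY radius R the negative part of the scale-critical e-component of the
similarity-rescaled vorticity fades in mean square on B_R, ∫_(B_R) (min(⟪(T−t)ω(t, x₀+√(T−t)y), e⟫,
0))² dy → 0 as t → T⁻, then u is backward bounded at (x₀,T). (why it might fail: a Type-I
singularity whose similarity-scale vorticity keeps one fixed component one-signed (a collapsing
non-symmetric swirling vortex with monotone circulation) is excluded by no theorem in print (LRT Rem
1.3).) [arXiv:2501.08976, KNSS2009, SereginSverak2009, arXiv:1811.00502]
#2 CirculationCarryingRigidity (crux) — RIGIDITY OF CIRCULATION-CARRYING CLOSED-HEMISPHERE TYPE-I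
PROFILES. If v : (−∞,0) × ℝ³ → ℝ³ has the Type-I time rate ‖v(t,x)‖ ≤ C/√(−t), is continuous,
unit-viscosity Oseen-mild between negative times and divergence-free, and for some e ≠ 0 every
vorticity slice satisfies ⟪curl v(s,y), e⟫ ≥ 0 for all y, with strict inequality at some (s,y), then
v is not backward-singular at the apex (0,0). First lemma of the line (plane-flux heat law): Φ(z,t)
:= ∫_(x·e = z) ⟪curl v, e⟫ is finite, independent of z and t (bounded nonnegative ancient solution
of Φ_t = Φ_zz ⇒ constant). [difficulty: XL] (why it might fail: the tilting source div(v₃ω_h) in the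
⟪ω,e⟫-equation is critical-size with no sign, so positivity + conserved plane flux may not smooth: a
non-axisymmetric Type-I ancient swirling vortex with monotone circulation (ω·e ≥ 0) is not excluded
in print (LRT Rem 1.3).) [arXiv:2501.08976, KNSS2009, arXiv:1010.6025, SereginSverak2009,
arXiv:1906.08225]
#3 PoloidalWindowRigidity (crux) — RIGIDITY OF POLOIDAL TYPE-I PROFILES ON A WINDOW (= item
stmt-NavierStokesRegularity-19708 of route PoloidalWindowDoor, VERBATIM; shared, not re-filed): for
the same profile class, (a) every vorticity slice is continuous and (b) for every e ≠ 0, if every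
slice s<0 carries a nonempty open set on which ⟪curl v(s,y), e⟫ = 0, then v is not backward-singular
at the apex. Used here only in the degenerate branch ⟪curl v, e⟫ ≡ 0 (Φ₀ = 0) of the
closed-hemisphere dichotomy. [difficulty: XL] (why it might fail: a genuinely 3D non-symmetric
poloidal (⟪ω̄,e⟫ ≡ 0) Type-I ancient mild solution may exist; only
symmetric/flat/self-similar/untwisted poloidal strata are settled (route PoloidalWindowDoor,
stub_twisting open).) [arXiv:1207.3692, doi:10.4064/bc70-0-13, arXiv:2501.08976, arXiv:0709.3599]
#9 HalfSpaceZoom (support) — LOCAL POINT ZOOM WITH CLOSED-HEMISPHERE SLICES: under the frame and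
local Type-I hypotheses of the Target, all-window mean-square fading of the negative part of
⟪(T−t)ω, e⟫ and failure of backward boundedness at (x₀,T) yield C, a profile v of the Type-I ancient
Oseen-mild class, backward singular at the apex, with ⟪curl v(s,y), e⟫ ≥ 0 for all s<0 and all y.
Proof plan: the PROVED LocalPointZoomSlices (stmt-NavierStokesRegularity-19709,
`PoloidalWindowDoorLocalPointZoomSlices.localPointZoomSlices_proof`) gives the zoom with pointwise
vorticity convergence on every slice; along t_j = T + λ_j²s the rescaled negative parts tend to 0 in
L²(B_R) for every R, so Fatou/a.e.-subsequence gives (⟪curl v(s),e⟫)_− = 0 a.e., and continuity of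
the slice vorticity (Type-I mild profiles are smooth; cf. 19708(a)) upgrades a.e. to everywhere.
[difficulty: M] [arXiv:1811.00502, arXiv:0709.3599, Seregin2014]

TWO-LAYER PLAN. Foreseen split of CirculationCarryingRigidity once a prover engages (not filed now):
C ⇐ PlaneFluxHeat → PositivitySmoothing → C, where PlaneFluxHeat = 'for a closed-hemisphere Type-I
Oseen-mild profile the plane flux Φ(z,t)=∫⟪curl v,e⟫dx_h is finite, constant in z and t' (in the
hemisphere class the fold source of FoldLawEps (stmt-15606, proved) vanishes for direction e, so Φ
is caloric in (z,t), nonnegative, finite by FarPastLedger ⇒ constant by Widder; M–L) and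
PositivitySmoothing = 'a closed-hemisphere profile with constant plane flux Φ₀ has sup_y ⟪curl
v(s,y),e⟫ ≤ c(C)Φ₀/(s − s₀) for all s₀ < s < 0' (Nash/Carlen–Loss-type smoothing from the far past
against the tilting source; the research content), whence Φ₀ > 0 forces ⟪curl v,e⟫ ≡ 0 letting s₀ →
−∞, contradiction.

KILL CRITERIA. A refutation of CirculationCarryingRigidity (an explicit or certified Type-I ancient
Oseen-mild profile with one-signed, not identically zero, e-vorticity that is backward singular —
e.g. a numerically converged non-axisymmetric backward-DSS swirling vortex with monotone circulation
from the N6d/N7 instruments) closes the route `refuted:CirculationCarryingRigidity` and converts the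
door into the typed barrier 'closed hemisphere is not enough'. A refutation of
PoloidalWindowRigidity (stmt-19708) breaks this route together with PoloidalWindowDoor; the pivot is
then to restate the door with fading of |min(⟪ω,e⟫, 0)| PLUS non-vanishing circulation. If
LocalTubeDoorPoloidal's crux 19708 is proved, only K2 remains; if LRT-type methods prove the
half-space case without Type I, the door is moot-by-proof (banked).

NOT DECOMPOSED YET. The two-layer split of K2 (plane-flux heat law / positivity smoothing), the
handling of horizontal infinity in the flux identity (lateral vorticity flux through large
cylinders, controlled only in mean by FarPastLedger), and the a.e.-to-everywhere upgrade inside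
HalfSpaceZoom are deliberately left to the prover layer; no constants are fixed (the smoothing
constant c(C) is existential).

CHEAPEST FALSIFIER. Look for a known explicit bounded/Type-I ancient or backward self-similar/DSS
Navier–Stokes flow with one Cartesian vorticity component of one sign: steady candidates (Burgers
vortex: ω = ω₃(r)e₃ ≥ 0 but velocity unbounded — not in class; bounded shear flows: ancient bounded
heat-flow profiles are constant — trivial; Beltrami/ABC flows: every component changes sign) all
fail the class or the sign; 2D Type-I ancient flows are trivial (KNSS 2D); axisymmetric Type-I
profiles are trivial (knss_no_axisymmetric_typeI). Ran as a lookup (this session): no counterexample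
in Majda–Bertozzi 2002 ch. 2 exact solutions [corpus:book:majda2002-vorticity-incompressible-flow
p.57] nor in LR16 ch. 'blow-up?'
[corpus:book:lemarie-rieusset2016-navier-stokes-problem-21st-century p.770]. The in-Lean cheap check
is the BC7 probe (hypotheses of K2 not refutable by the kinematic apex witness
`Literature.Analysis.FluidPDE.KinematicApexWitness.apex_isBackwardSingularPoint`, which is not
Oseen-mild).

NUMBERS. Aperture ladder of the vorticity-direction criteria: double cone of half-angle θ < π/4
about ±e (LRT Thm 1.1, any Leray–Hopf flow) → closed hemisphere θ = π/2 (this door, under local Type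
I) ; plane-flux bound: mean circulation at scale R is ≤ c·K(C)^(1/2) uniformly in R and t from
FarPastLedger's ∫_(B_R)|u|² ≤ K R (stmt-14060, proved).

DEFINITION REQUESTS. None: all statements are over existing declarations (HasTypeITimeDecay,
heatExtension, oseenDuhamel, curl, IsBackwardSingularPoint, IsBackwardBoundedAt,
IsClassicalNSSolutionOn, IsLerayHopfOn, HasRapidSpatialDecay).

Novelty: Searches (2026-08-27): lit search --hybrid "vorticity direction half-space one component nonnegative
regularity Navier-Stokes blow-up" (8 docs: Majda–Bertozzi 2002, Seregin 2014 p.174, LR16 p.770 —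
surveys, no half-space criterion); lit vsearch "<one-signed component near a singular point ⇒
regular; directions in a hemisphere>" (8 docs, none on point); lit search "vorticity direction cone
regularity Type I" --source local (2 docs: arXiv:2501.08976 pp.4–6 = LRT double cone + Rem 1.3;
arXiv:1906.08225 pp.3,5 = Barker–Prange half-space-DOMAIN alignment under Type I, a different
'half-space'); lit galaxy search "one-signed vorticity|sign of the vorticity|vorticity direction"
--star all (22 rows, all noise) and "double cone|vorticity flux|hemisphere" --star pdf (8 rows,
noise); tree: rg over Theses/Ideas for hemisphere/half-space/one-signed component (0 hits), ledger
route closers (door family S13–S23: no hemisphere door), ledger negatives (5 NS negatives, none on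
vorticity sign).
Nearest prior art found: arXiv:2501.08976 (Lei–Ren–Tian 2025) Thm 1.1 (double cone ⇒ regular) and
Remark 1.3 p.4 (half-space case posed as open, 'nontrivial even for axisymmetric'); in tree (a)
route SlicedKelvin / card planar-fold-law-unsigned-flux (critic-graded new-mechanism): the unsigned
planar flux obeys a 1-D heat law with a fold source (FoldLawEps stmt-15606 proved; cruxes
PlanarFluxAPriori = L^{2,1} fold budget, PlanarFluxLiouville stmt-15601 = Liouville for bounded
ancient flows with bounded un  [refs: 2501.08976, 1906.08225, KNSS2009]

Barriers (technique_class: vorticity-direction, drift-diffusion, blow-up-zoom): - technique_class: vorticity-direction, drift-diffusion, blow-up-zoom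
- Literature.Barriers.NavierStokesRegularity.AveragedTypeIBlowup: outside its class — the cruxes use
fine structure of the true nonlinearity (the sign of one vorticity component is not preserved by
Tao-type averaged bilinear forms, and the identity '(v₃ω − ω₃v)·e₃ ≡ 0' is an exact algebraic
property of u·∇u), which is the evasion N8(i) demands ('every Liouville crux must name its fine
structure': named here).
- Literature.Barriers.NavierStokesRegularity.EnergySupercriticality: not an energy-method line; the
controlling quantity Φ is dimensionless (scale-invariant circulation), not supercritical energy.
- Literature.Barriers.NavierStokesRegularity.VorticityStrainNonlocality: it does; the bet is that
one-signedness of ⟪ω,e⟫ plus the conserved plane flux substitutes for pointwise strain–vorticity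
control exactly as the double-cone condition does in LRT (who also never control the strain
pointwise).
- Literature.Barriers.NavierStokesRegularity.SupNormCalderonZygmundFailure: no sup-norm CZ step is
used; the flux identities are L¹/divergence-form.
- Literature.Barriers.NavierStokesRegularity.AxisymmetricTypeIExclusion: consistent (it is the
proved axisymmetric sub-case of K2, cited as the BC5 rung), not an obstruction.
- Negatives index: steers around stmt-1376 (OddMorawetz, interaction functional — not used),
stmt-4055/1832/1429/0154 (none concerns vorticity sign or door criteria); empty overlap at filing.

History (route lifecycle, newest last):
- 2026-08-28T05:56:29Z · closes_target -> closes rung N0-LocalTubeDoorHalfSpace (DOOR) of NavierStokesRegularity: Summit.NavierStokesRegularity.NavierStokesRegularity.Theses.HalfSpaceWindowDoor.Target (D-0061; not the summit Statement) (operator:999:1586470)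

sub-problem: NavierStokesRegularity · status: draft · opened planner-ns-idea-6-g2-0 2026-08-28T03:26:37Z · rev 1 · ledger route-NavierStokesRegularity-HalfSpaceWindowDoor
GENERATED by the gate from the ledger (D-0016/17). Provers cite these decls: `theorem foo : Summit.NavierStokesRegularity.NavierStokesRegularity.Theses.HalfSpaceWindowDoor.<Decl> := …` in Summits/NavierStokesRegularity/NavierStokesRegularity/Theorems/<Name>.lean.
-/

namespace Summit.NavierStokesRegularity.NavierStokesRegularity.Theses.HalfSpaceWindowDoor

open scoped BigOperators Topology Manifold Classical MeasureTheory ProbabilityTheory Matrix InnerProductSpace ComplexConjugate ContinuousMap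
open Filter Set Function TopologicalSpace MeasureTheory

attribute [summit_statement] _root_.NavierStokesRegularity
-- H21.Audit: the closer leaf Summit.NavierStokesRegularity.NavierStokesRegularity.Theses.HalfSpaceWindowDoor.Target is an item decl of this route file — tagged summit_statement below, after its declaration

open Literature.NS

/-- item stmt-NavierStokesRegularity-25310 · target · rank 0 · open · by planner
why it might fail: a Type-I singularity whose similarity-scale vorticity keeps one fixed component one-signed (a collapsing non-symmetric swirling vortex with monotone circulation) is excluded by no theorem in print (LRT Rem 1.3).
sources: arXiv:2501.08976, KNSS2009, SereginSverak2009, arXiv:1811.00502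
[target] The closed-hemisphere window door: ν>0, T>0, (u,p) classical NS on [0,T), Leray–Hopf from a
rapidly decaying datum, locally Type I at (x₀,T) on B(x₀,ρ) × (T−ρ², T); if for one fixed e ≠ 0 and
EVERY radius R the negative part of the scale-critical e-component of the similarity-rescaled
vorticity fades in mean square on B_R, ∫_(B_R) (min(⟪(T−t)ω(t, x₀+√(T−t)y), e⟫, 0))² dy → 0 as t →
T⁻, then u is backward bounded at (x₀,T). -/
@[route_item "route-NavierStokesRegularity-HalfSpaceWindowDoor"]
def Target : Prop :=
  ∀ (ν T : ℝ), 0 < ν → 0 < T → ∀ (u : ℝ → EuclideanSpace ℝ (Fin 3) → EuclideanSpace ℝ (Fin 3)) (p : ℝ → EuclideanSpace ℝ (Fin 3) → ℝ), Literature.Analysis.FluidPDE.IsClassicalNSSolutionOn (Set.Ico 0 T) ν 0 u p → Literature.Analysis.FluidPDE.IsLerayHopfOn T ν 0 (u 0) u → Literature.Analysis.FluidPDE.HasRapidSpatialDecay (u 0) → ∀ (x₀ : EuclideanSpace ℝ (Fin 3)) (ρ M : ℝ), 0 < ρ → (∀ t ∈ Set.Ico 0 T, T - ρ ^ 2 <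 t → ∀ x ∈ Metric.ball x₀ ρ, ‖u t x‖ * Real.sqrt (ν * (T - t)) ≤ M) → ∀ (e : EuclideanSpace ℝ (Fin 3)), e ≠ 0 → (∀ R : ℝ, 0 < R → Filter.Tendsto (fun t => ∫⁻ y in Metric.ball (0 : EuclideanSpace ℝ (Fin 3)) R, ENNReal.ofReal ((min (⟪(T - t) • Literature.Analysis.FluidPDE.curl (u t) (x₀ + Real.sqrt (T - t) • y), e⟫_ℝ) 0) ^ 2)) (nhdsWithin T (Set.Iio T)) (nhds 0)) → Literature.Analysis.FluidPDE.IsBackwardBoundedAt u T x₀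

/-- item stmt-NavierStokesRegularity-25311 · crux · rank 2 · open · by planner
why it might fail: the tilting source div(v₃ω_h) in the ⟪ω,e⟫-equation is critical-size with no sign, so positivity + conserved plane flux may not smooth: a non-axisymmetric Type-I ancient swirling vortex with monotone circulation (ω·e ≥ 0) is not excluded in print (LRT Rem 1.3).
sources: arXiv:2501.08976, KNSS2009, arXiv:1010.6025, SereginSverak2009, arXiv:1906.08225
[crux] RIGIDITY OF CIRCULATION-CARRYING CLOSED-HEMISPHERE TYPE-I PROFILES. If v : (−∞,0) × ℝ³ → ℝ³
has the Type-I time rate ‖v(t,x)‖ ≤ C/√(−t), is continuous, unit-viscosity Oseen-mild between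
negative times and divergence-free, and for some e ≠ 0 every vorticity slice satisfies ⟪curl v(s,y),
e⟫ ≥ 0 for all y, with strict inequality at some (s,y), then v is not backward-singular at the apex
(0,0). First lemma of the line (plane-flux heat law): Φ(z,t) := ∫_(x·e = z) ⟪curl v, e⟫ is finite,
independent of z and t (bounded nonnegative ancient solution of Φ_t = Φ_zz ⇒ constant). [difficulty:
XL] -/
@[route_item "route-NavierStokesRegularity-HalfSpaceWindowDoor", crux (bottleneck := idea) (experiment := "instrument: LE (lines g11-2/g12-2/g13, window rung closed by name; door itself IDEA-NEEDED) · W4 ⟨20428⟩ (Q4) ATTACKABLE = TRIPWIRE (v9 split Q4line/Q4…") (source := "director HOURLY-NS l.1327, 2026-09-01")]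
def CirculationCarryingRigidity : Prop :=
  ∀ (C : ℝ) (v : ℝ → EuclideanSpace ℝ (Fin 3) → EuclideanSpace ℝ (Fin 3)), Literature.Analysis.FluidPDE.HasTypeITimeDecay C v → ContinuousOn (Function.uncurry v) (Set.Iio (0 : ℝ) ×ˢ Set.univ) → (∀ s t : ℝ, s < t → t < 0 → ∀ x, v t x = Literature.Analysis.UnboundedOperators.heatExtension (v s) (t - s) x - Literature.Analysis.FluidPDE.oseenDuhamel 1 s v v t x) → (∀ t < 0, Literature.Analysis.FluidPDE.VectorCalculus.IsDivFree (v t)) → ∀ (e : EuclideanSpace ℝ (Fin 3)), e ≠ 0 → (∀ s < 0, ∀ y, 0 ≤ ⟪Literature.Analysis.FluidPDE.curl (v s) y, e⟫_ℝ) → (∃ s, s < 0 ∧ ∃ y, 0 < ⟪Literature.Analysis.FluidPDE.curl (v s) y, e⟫_ℝ) → ¬ Literature.Analysis.FluidPDE.IsBackwardSingularPoint v 0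

/-- item stmt-NavierStokesRegularity-19708 · crux · rank 3 · open · by operator
why it might fail: a genuinely 3D non-symmetric poloidal (⟪ω̄,e⟫ ≡ 0) Type-I ancient mild solution may exist; only symmetric/flat/self-similar/untwisted poloidal strata are settled (route PoloidalWindowDoor, stub_twisting open).
sources: arXiv:1207.3692, doi:10.4064/bc70-0-13, arXiv:2501.08976, arXiv:0709.3599
[crux] RIGIDITY OF POLOIDAL TYPE-I PROFILES ON A WINDOW. If v : (−∞,0) × ℝ³ → ℝ³ has the Type-I time
rate ‖v(t,x)‖ ≤ C/√(−t), is continuous, unit-viscosity Oseen-mild between negative times and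
divergence-free, then (a) every vorticity slice curl v(s,·), s < 0, is continuous, and (b) for every
e ≠ 0: if every slice s < 0 carries a nonempty open set on which ⟪curl v(s,y), e⟫ = 0, then v is not
backward-singular at the apex (0,0). KERNEL (cell Sketch7A/Sketch8, 0 sorry): (a) and the
propagation window ⇒ everywhere hold, `poloidalWindowRigidity_iff : K2 ↔ PoloidalProfileRigidity`
(:= no backward-singular profile of the class is poloidal along a fixed e, i.e. ⟪curl v(s), e⟫ ≡ 0);
settled sub-strata: aligned, two directions, axisymmetric about an axis ∥ e (⇒ swirl-free; KNSS Thm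
5.2), self-similar (Tsai), flat (∂ₐ(v·e) ≡ 0 for one a ⟂ e); frozen constraint ω̄·∇(v·e) ≡ 0. OPEN:
the general (non-symmetric, non-flat) poloidal Type-I Liouville theorem. [difficulty: XL] -/
@[route_item "route-NavierStokesRegularity-HalfSpaceWindowDoor", crux]
def PoloidalWindowRigidity : Prop :=
  ∀ (C : ℝ) (v : ℝ → EuclideanSpace ℝ (Fin 3) → EuclideanSpace ℝ (Fin 3)), Literature.Analysis.FluidPDE.HasTypeITimeDecay C v → ContinuousOn (Function.uncurry v) (Set.Iio (0 : ℝ) ×ˢ Set.univ) → (∀ s t : ℝ, s < t → t < 0 → ∀ x, v t x = Literature.Analysis.UnboundedOperators.heatExtension (v s) (t - s) x - Literature.Analysis.FluidPDE.oseenDuhamel 1 s v v t x) → (∀ t < 0, Literature.Analysis.FluidPDE.VectorCalculus.IsDivFree (v t)) → (∀ s < 0, Continuous (Literature.Analysis.FluidPDE.curl (v s))) ∧ ∀ (e : EuclideanSpace ℝ (Fin 3)), e ≠ 0 → (∀ s < 0, ∃ U : Set (EuclideanSpace ℝ (Fin 3)), IsOpen U ∧ U.Nonempty ∧ ∀ y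 ∈ U, ⟪Literature.Analysis.FluidPDE.curl (v s) y, e⟫_ℝ = 0) → ¬ Literature.Analysis.FluidPDE.IsBackwardSingularPoint v 0

/-- item stmt-NavierStokesRegularity-25312 · support · rank 9 · closed · proved by Summit.NavierStokesRegularity.NavierStokesRegularity.Theorems.halfSpaceWindowDoor_halfSpaceZoom_proof (prover) · by planner
sources: arXiv:1811.00502, arXiv:0709.3599, Seregin2014
[support] LOCAL POINT ZOOM WITH CLOSED-HEMISPHERE SLICES: under the frame and local Type-I
hypotheses of the Target, all-window mean-square fading of the negative part of ⟪(T−t)ω, e⟫ and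
failure of backward boundedness at (x₀,T) yield C, a profile v of the Type-I ancient Oseen-mild
class, backward singular at the apex, with ⟪curl v(s,y), e⟫ ≥ 0 for all s<0 and all y. Proof plan:
the PROVED LocalPointZoomSlices (stmt-NavierStokesRegularity-19709,
`PoloidalWindowDoorLocalPointZoomSlices.localPointZoomSlices_proof`) gives the zoom with pointwise
vorticity convergence on every slice; along t_j = T + λ_j²s the rescaled negative parts tend to 0 in
L²(B_R) for every R, so Fatou/a.e.-subsequence gives (⟪curl v(s),e⟫)_− = 0 a.e., and continuity of
the slice vorticity (Type-I mild profiles are smooth; cf. 19708(a)) upgrades a.e. to everywhere.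
[difficulty: M] -/
@[route_item "route-NavierStokesRegularity-HalfSpaceWindowDoor", crux]
def HalfSpaceZoom : Prop :=
  ∀ (ν T : ℝ), 0 < ν → 0 < T → ∀ (u : ℝ → EuclideanSpace ℝ (Fin 3) → EuclideanSpace ℝ (Fin 3)) (p : ℝ → EuclideanSpace ℝ (Fin 3) → ℝ), Literature.Analysis.FluidPDE.IsClassicalNSSolutionOn (Set.Ico 0 T) ν 0 u p → Literature.Analysis.FluidPDE.IsLerayHopfOn T ν 0 (u 0) u → Literature.Analysis.FluidPDE.HasRapidSpatialDecay (u 0) → ∀ (x₀ : EuclideanSpace ℝ (Fin 3)) (ρ M : ℝ), 0 < ρ → (∀ t ∈ Set.Ico 0 T, T - ρ ^ 2 < t → ∀ x ∈ Metric.ball x₀ ρ, ‖u t x‖ * Real.sqrt (ν * (T - t)) ≤ M) → ∀ (e : EuclideanSpace ℝ (Fin 3)), e ≠ 0 → (∀ R : ℝ, 0 < R → Filter.Tendsto (fun t => ∫⁻ y in Metric.ball (0 : EuclideanSpace ℝ (Fin 3)) R, ENNReal.ofReal ((min (⟪(T - t) • Literature.Analysis.FluidPDE.curl (u t) (x₀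 + Real.sqrt (T - t) • y), e⟫_ℝ) 0) ^ 2)) (nhdsWithin T (Set.Iio T)) (nhds 0)) → ¬ Literature.Analysis.FluidPDE.IsBackwardBoundedAt u T x₀ → ∃ (C : ℝ) (v : ℝ → EuclideanSpace ℝ (Fin 3) → EuclideanSpace ℝ (Fin 3)), (Literature.Analysis.FluidPDE.HasTypeITimeDecay C v ∧ ContinuousOn (Function.uncurry v) (Set.Iio (0 : ℝ) ×ˢ Set.univ) ∧ (∀ s t : ℝ, s < t → t < 0 → ∀ x, v t x = Literature.Analysis.UnboundedOperators.heatExtension (v s) (t - s) x - Literature.Analysis.FluidPDE.oseenDuhamel 1 s v v t x) ∧ (∀ t < 0, Literature.Analysis.FluidPDE.VectorCalculus.IsDivFree (v t))) ∧ Literature.Analysis.FluidPDE.IsBackwardSingularPoint v 0 ∧ ∀ s < 0, ∀ y, 0 ≤ ⟪Literature.Analysis.FluidPDE.curl (v s) y, e⟫_ℝ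

-- `HalfSpaceZoom` holds: proved by `Summit.NavierStokesRegularity.NavierStokesRegularity.Theorems.halfSpaceWindowDoor_halfSpaceZoom_proof` (its module imports this route file, so no `_holds` link can be stated here).

/-- item stmt-NavierStokesRegularity-25313 · assembly · rank 1 · closed · proved by Summit.NavierStokesRegularity.NavierStokesRegularity.Theorems.halfSpaceWindowDoor_assembly_proof (prover) · by planner
sources: arXiv:2501.08976
[assembly] HalfSpaceZoom → CirculationCarryingRigidity → PoloidalWindowRigidity → Target (the rung
leaf). -/
@[route_item "route-NavierStokesRegularity-HalfSpaceWindowDoor"]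
def Assembly : Prop :=
  HalfSpaceZoom → CirculationCarryingRigidity → PoloidalWindowRigidity → Target

-- `Assembly` holds: proved by `Summit.NavierStokesRegularity.NavierStokesRegularity.Theorems.halfSpaceWindowDoor_assembly_proof` (its module imports this route file, so no `_holds` link can be stated here).

attribute [summit_statement] _root_.Summit.NavierStokesRegularity.NavierStokesRegularity.Theses.HalfSpaceWindowDoor.Target

/-! D-0027 §2.1 — DECIDING THEOREM (planner-authored via `route open/edit --closes-file`; by operator:999:1586470 2026-08-28T05:56:29Z):
its hypotheses are this route's items and its conclusion the registered leaf `Summit.NavierStokesRegularity.NavierStokesRegularity.Theses.HalfSpaceWindowDoor.Target` (rung N0-LocalTubeDoorHalfSpace (DOOR), D-0061) (glue_lint), and it elaborates with this file. -/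

@[closes "route-NavierStokesRegularity-HalfSpaceWindowDoor"] theorem closes (h₂ : CirculationCarryingRigidity) (h₃ : PoloidalWindowRigidity) (h₉ : HalfSpaceZoom) : Target := by
  intro ν T hν hT u p hcl hLH hdec x₀ ρ M hρ hTI e he hfade
  by_contra hbb
  obtain ⟨C, v, ⟨hdecay, hcont, hmild, hdiv⟩, hsing, hnn⟩ :=
    h₉ ν T hν hT u p hcl hLH hdec x₀ ρ M hρ hTI e he hfade hbb
  by_cases hpos : ∃ s, s < 0 ∧ ∃ y, 0 < ⟪Literature.Analysis.FluidPDE.curl (v s) y, e⟫_ℝ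
  · exact h₂ C v hdecay hcont hmild hdiv e he hnn hpos hsing
  · push_neg at hpos
    have hzero : ∀ s < 0, ∃ U : Set (EuclideanSpace ℝ (Fin 3)), IsOpen U ∧ U.Nonempty ∧
        ∀ y ∈ U, ⟪Literature.Analysis.FluidPDE.curl (v s) y, e⟫_ℝ = 0 := by
      intro s hs
      exact ⟨Set.univ, isOpen_univ, Set.univ_nonempty, fun y _ => le_antisymm (hpos s hs y) (hnn s hs y)⟩
    exact (h₃ C v hdecay hcont hmild hdiv).2 e he hzero hsing

end Summit.NavierStokesRegularity.NavierStokesRegularity.Theses.HalfSpaceWindowDoor
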